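import Summits.QuantumFields.YangMills.Theorems.UnitScaleTiltProp7SmoothUntwistDatum
import Summits.QuantumFields.YangMills.Theorems.UnitScaleTiltProp7CovLaplaceSpectralSplit
import HarnessLib

/-!
# Route `UnitScaleTilt`, crux K1 «MinimiserStabilityRegPr» (stmt-QuantumFields-19200), route-R E′ path (α′), (E1) «pinned slice theorem» — its STARTING POINT (row R2 ∕ (F1′)):
# THE `En` DATUM ROWS OF THE (E1-e) KNIT — for the untwisted start `X := e^{iD‴}W` on the fibre: `En μ y := ↑(X_{(y,μ)}·W_{(y,μ)}⁻¹) = e^{iD‴(y,μ)}`, `‖En − 1‖ < 1`,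
# `ℓ·‖log En‖ ≤ S₁`, `ℓ²·‖divB 𝒰 (log ∘ En)‖ ≤ S₂` pointwise, `ℓ = (F.L : ℝ)^(K−n)` — the letters of ✓ `Prop7ExactCorrectorHNMember.hN_member` (`hE1 hEβ hEdiv`)

Cell `ym3-torus`, width seat `ym-ust-19200-w1` (gen 12); LOCATE `LOCATE-F1PRIME-SMOOTH-UNTWIST-w1g12.md` (19200 evidence n = 55), file (U7) — the `En`-reading of ✓ `Prop7SmoothUntwistSocket` (U5) for
ym3-torus-px13's (E1-e) knit (★p1 g16 NAMER WORD 8, 2026-08-28 23:49Z).  THEOREMS ONLY (0 `def`, 0 `sorry`); `--supports stmt-QuantumFields-19200`, count-neutral.  YM₃ on T³ is a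
ladder rung (R3), not the Clay problem; nothing here claims a stub, the crux, d = 4 or the mass gap; (E1) is NOT closed by this file.

WHY.  The (E1-e) knit displays, per member and competitor, a starting representative `X ∈ (6)(e) ∩ 𝔅_k(V)` with the SAME action as the competitor and the datum rows of
✓ `hN_member`∕✓ `exists_exact_corrector_member′` on `En μ y := ↑(X_{(y,μ)}W_{(y,μ)}⁻¹)`: `‖En μ y − 1‖ < 1`, `ℓ·‖mlog (En μ y)‖ ≤ s`, `ℓ²·‖divB 𝒰 (fun μ y => mlog (En μ y)) x‖ ≤ s`.  Print's
Landau representative of a competitor `W′` is TWISTED out of the fibre by `u` ([Balaban1985RegularSpaces] (1.29)–(1.30)); the untwisted start with both rows is (U3)–(U5).  THIS FILE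
reads (U5)'s chart `D‴` as `X := emb15 W (expHermField D‴)`: then `En = e^{iD‴}` exactly, `mlog En = i·D‴` (`‖D‴‖ ≤ S₁ ≤ 1∕4 < log 2`), `divB 𝒰 (mlog ∘ En) = i·divB 𝒰 D‴` — so the
knit's three `En` rows hold with `s := max S₁ S₂`, from print's `s₀ s₁′ σ` and the frames only.

WHAT IS PROVED (ns `…Theorems.Prop7SmoothUntwistEnRows`).
* `S₁_le_quarter` — the window arithmetic `S₁ ≤ 1∕4` under `s₀ ≤ 1∕64`, `σ ≤ 1∕1024`, `K₁ ≤ 1∕256`.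
* ★★★ `exists_untwistedStart_En_T3` — `∃ D‴` Hermitian-traceless with `e^{iD‴}W ∈ (6)(e) ∩ 𝔅_k(V)`, `A((e^{iA₀}W)^u) = A(e^{iD‴}W)`, and for `En μ y := ↑((e^{iD‴}W)_{(y,μ)}·W_{(y,μ)}⁻¹)`:
  `En μ y = exp (i•D‴(y,μ))`, `‖En μ y − 1‖ < 1`, `ℓ·‖mlog (En μ y)‖ ≤ S₁`, `ℓ²·‖divB 𝒰 (fun μ y => mlog (En μ y)) x‖ ≤ S₂`.
HONEST SCOPE.  Re-lettering of (U5); displayed exactly what (U5) displays (frames with `c₀ c₁`; `s₀ s₁′ σ`).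

References: T. Bałaban, CMP 99 (1985) 75–102 [Balaban1985RegularSpaces] ((1.29)–(1.30) p.81, (1.36) p.82, (1.72) p.88); CMP 102 (1985) 277–309 [Balaban1985Variational] ((15) p.280,
Prop. 7 p.299); CMP 98 (1985) 17–51 [Balaban1985Averaging] ((21) p.21).
-/

set_option autoImplicit false

noncomputable section

open scoped BigOperators Matrix.Norms.L2Operator Matrix
open NormedSpace

namespace Summit.QuantumFields.YangMills.Theorems.Prop7SmoothUntwistEnRows

open Literature.MathematicalPhysics.QuantumFieldTheory.Balaban1983to89
open Literature.MathematicalPhysics.QuantumFieldTheory.Balaban1983to89.T3ContinuumYM3Torus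
open Literature.MathematicalPhysics.QuantumFieldTheory.Balaban1983to89.T3PrintedRegularMinimiser (regFibrePr)
open Literature.MathematicalPhysics.QuantumFieldTheory.Balaban1983to89.T3SectALandauChart (emb15)
open T4Continuum
open B9Eq39Adjoint (divB)
open B9TorusCalculus (torusT)
open B10Eq27TorusAxialLog (unitsField toUField)
open B5Eq118OneStroke (iterBlockOf)
open B15DeterminingSets (embIter)
open MatrixLog (mlog)
open B7BlockAvgLog (mlog_exp)
open Summit.QuantumFields.YangMills.Theorems.Prop7TPrint (expHerm expHermField coe_expHerm)
open Summit.QuantumFields.YangMills.Theorems.Prop7SmoothUntwistSocket (exists_smoothUntwistedChart_socket_T3 norm_bond_le_of_pi)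
open Summit.QuantumFields.YangMills.Theorems.Prop7SmoothUntwistDatum (blockLetter_eq)
open Summit.QuantumFields.YangMills.Theorems.Prop7CovLaplaceSpectralSplit (divB_smul)

/-- window arithmetic: `S₁ = s₀ + (1+2s₀)(1+6σ)K₁ ≤ 1∕4` for `0 ≤ s₀ ≤ 1∕64`, `0 ≤ σ ≤ 1∕1024`, `0 ≤ K₁ ≤ 1∕256`. [folklore] -/
theorem S₁_le_quarter {s₀ σ K₁ : ℝ} (hs0 : 0 ≤ s₀) (hs : s₀ ≤ 1 / 64) (hσ0 : 0 ≤ σ) (hσ : σ ≤ 1 / 1024) (hK0 : 0 ≤ K₁) (hK : K₁ ≤ 1 / 256) :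
    s₀ + (1 + 2 * s₀) * ((1 + 6 * σ) * K₁) ≤ 1 / 4 := by
  nlinarith [mul_nonneg hs0 hK0, mul_nonneg hσ0 hK0, mul_nonneg (mul_nonneg hs0 hσ0) hK0]

/-- ★★★ **THE UNTWISTED START WITH THE KNIT'S `En` ROWS** — hypotheses of ✓ `exists_smoothUntwistedChart_socket_T3` verbatim; with `ℓ = (F.L : ℝ)^(K−n)`, `S₁ = s₀ + (1+2s₀)(1+6σ)K₁`,
`S₂ = s₁′ + d(K₂ + 9K₁² + 36σK₂) + d(6K₁s₀ + 4s₀(1+6σ)K₁)`: `∃ D‴` Hermitian-traceless, `X := emb15 W (expHermField D‴) ∈ (6)(e) ∩ 𝔅_k(V)` with `A((e^{iA₀}W)^u) = A(X)`, and the ratio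
`En μ y := ↑(X_{(y,μ)}·W_{(y,μ)}⁻¹)` satisfies `En μ y = exp (i•D‴(y,μ))`, `‖En μ y − 1‖ < 1`, `ℓ·‖mlog (En μ y)‖ ≤ S₁`, `ℓ²·‖divB 𝒰 (fun μ y => mlog (En μ y)) x‖ ≤ S₂`.
[cite: Balaban1985RegularSpaces, (1.29)-(1.30) p.81, (1.36) p.82, (1.72) p.88; Balaban1985Variational, (15) p.280; Balaban1985Averaging, (21) p.21] -/
theorem exists_untwistedStart_En_T3 (F : T3Family) {n K : ℕ} (h : n ≤ K) (hk1 : 1 ≤ K - n) {e s₀ s₁' σ a₀ a₁ c₀ c₁ : ℝ} (he : 0 ≤ e)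
    {V : GaugeField (F.P n) 0 (Matrix.specialUnitaryGroup (Fin 2) ℂ)} (W : GaugeField (F.P K) 0 (Matrix.specialUnitaryGroup (Fin 2) ℂ))
    (A₀ : PBond (F.P K) 0 → Matrix (Fin 2) (Fin 2) ℂ) (hA0 : ∀ b, (A₀ b).IsHermitian ∧ Matrix.trace (A₀ b) = 0)
    (hs₀ : ((((F.P K).L ^ (K - n) : ℕ)) : ℝ) * ‖(fun (μ : Fin (F.P K).d) (z : Site (F.P K) 0) => A₀ ⟨z, μ⟩)‖ ≤ s₀) (hs₀' : s₀ ≤ 1 / 64)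
    (hs₁ : ((((F.P K).L ^ (K - n) : ℕ)) : ℝ) ^ 2 * ‖(fun x => divB (torusT (F.P K) 0) (fun κ z => unitsField (toUField W) ⟨z, κ⟩) (fun μ z => A₀ ⟨z, μ⟩) x)‖ ≤ s₁')
    (u : GaugeTransf (F.P K) 0 (Matrix.specialUnitaryGroup (Fin 2) ℂ)) (hXu : GaugeField.gaugeAct u (emb15 W (expHermField A₀)) ∈ regFibrePr F n K h e V)
    (hσ : ∀ y : Site (F.P K) (K - n), dist1 (u (embIter (K - n) y)) ≤ σ) (hσ0 : σ ≤ 1 / 1024) (hσc : ((6 + 2 * c₀) * (2 * σ)) ≤ 1 / 256)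
    (Fr : Site (F.P K) (K - n) → Site (F.P K) 0 → (Matrix (Fin 2) (Fin 2) ℂ)ˣ)
    (hFr : ∀ y z, ‖(Fr y z : Matrix (Fin 2) (Fin 2) ℂ)‖ ≤ 1 ∧ ‖(((Fr y z)⁻¹ : (Matrix (Fin 2) (Fin 2) ℂ)ˣ) : Matrix (Fin 2) (Fin 2) ℂ)‖ ≤ 1) (hFr1 : ∀ y, Fr y (embIter (K - n) y) = 1)
    (ha₀ : 0 ≤ a₀) (ha₁ : 0 ≤ a₁) (hc₀ : ((((F.P K).L ^ (K - n) : ℕ)) : ℝ) * a₀ ≤ c₀) (hc₁ : ((((F.P K).L ^ (K - n) : ℕ)) : ℝ) ^ 2 * a₁ ≤ c₁)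
    (hA : ∀ (y : Site (F.P K) (K - n)) (z : Site (F.P K) 0), (∀ ν : Fin (F.P K).d, (y ν = (iterBlockOf (K - n) (fun κ => z κ - (((((F.P K).L ^ (K - n) - 1) / 2 : ℕ)) : ZMod ((F.P K).sitesPerDir 0)))) ν - 1 ∨ y ν = (iterBlockOf (K - n) (fun κ => z κ - (((((F.P K).L ^ (K - n) - 1) / 2 : ℕ)) : ZMod ((F.P K).sitesPerDir 0)))) ν ∨ y ν = (iterBlockOf (K - n) (fun κ => z κ - (((((F.P K).L ^ (K - n) - 1) / 2 : ℕ)) : ZMod ((F.P K).sitesPerDir 0)))) ν + 1 ∨ y ν = (iterBlockOf (K - n) (fun κ => z κ - (((((F.P K).L ^ (K - n) - 1) / 2 : ℕ)) : ZMod ((F.P K).sitesPerDir 0)))) ν + 2)) → ∀ μ : Fin (F.P K).d,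
      ‖(((Fr y z)⁻¹ * unitsField (toUField W) ⟨z, μ⟩ * Fr y (torusT (F.P K) 0 μ z) : (Matrix (Fin 2) (Fin 2) ℂ)ˣ) : Matrix (Fin 2) (Fin 2) ℂ) - 1‖ ≤ a₀
      ∧ ‖(((Fr y ((torusT (F.P K) 0 μ).symm z))⁻¹ * unitsField (toUField W) ⟨(torusT (F.P K) 0 μ).symm z, μ⟩ * Fr y z : (Matrix (Fin 2) (Fin 2) ℂ)ˣ) : Matrix (Fin 2) (Fin 2) ℂ) - 1‖ ≤ a₀
      ∧ ‖(((Fr y z)⁻¹ * unitsField (toUField W) ⟨z, μ⟩ * Fr y (torusT (F.P K) 0 μ z) : (Matrix (Fin 2) (Fin 2) ℂ)ˣ) : Matrix (Fin 2) (Fin 2) ℂ)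
          - (((Fr y ((torusT (F.P K) 0 μ).symm z))⁻¹ * unitsField (toUField W) ⟨(torusT (F.P K) 0 μ).symm z, μ⟩ * Fr y z : (Matrix (Fin 2) (Fin 2) ℂ)ˣ) : Matrix (Fin 2) (Fin 2) ℂ)‖ ≤ a₁) :
    ∃ D : PBond (F.P K) 0 → Matrix (Fin 2) (Fin 2) ℂ,
      (∀ b, (D b).IsHermitian ∧ Matrix.trace (D b) = 0) ∧
      emb15 W (expHermField D) ∈ regFibrePr F n K h e V ∧
      wilsonAction4 (GaugeField.gaugeAct u (emb15 W (expHermField A₀))) = wilsonAction4 (emb15 W (expHermField D)) ∧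
      (∀ (μ : Fin (F.P K).d) (y : Site (F.P K) 0), (((emb15 W (expHermField D) ⟨y, μ⟩ * (W ⟨y, μ⟩)⁻¹ : Matrix.specialUnitaryGroup (Fin 2) ℂ) : Matrix (Fin 2) (Fin 2) ℂ)) = exp (Complex.I • D ⟨y, μ⟩)) ∧
      (∀ (μ : Fin (F.P K).d) (y : Site (F.P K) 0), ‖(((emb15 W (expHermField D) ⟨y, μ⟩ * (W ⟨y, μ⟩)⁻¹ : Matrix.specialUnitaryGroup (Fin 2) ℂ) : Matrix (Fin 2) (Fin 2) ℂ)) - 1‖ < 1) ∧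
      (∀ (μ : Fin (F.P K).d) (y : Site (F.P K) 0), ((F.L : ℝ) ^ (K - n)) * ‖mlog (((emb15 W (expHermField D) ⟨y, μ⟩ * (W ⟨y, μ⟩)⁻¹ : Matrix.specialUnitaryGroup (Fin 2) ℂ) : Matrix (Fin 2) (Fin 2) ℂ))‖ ≤ (s₀ + (1 + 2 * s₀) * ((1 + 6 * σ) * ((6 + 2 * c₀) * (2 * σ))))) ∧
      (∀ x : Site (F.P K) 0, ((F.L : ℝ) ^ (K - n)) ^ 2 * ‖divB (torusT (F.P K) 0) (fun κ z => unitsField (toUField W) ⟨z, κ⟩) (fun μ y => mlog (((emb15 W (expHermField D) ⟨y, μ⟩ * (W ⟨y, μ⟩)⁻¹ : Matrix.specialUnitaryGroup (Fin 2) ℂ) : Matrix (Fin 2) (Fin 2) ℂ))) x‖ ≤ (s₁' + ((F.P K).d : ℝ) * (((2 * (c₁ + 2 * c₀ ^ 2) + 24 * c₀ + 24) * (2 * σ)) + 9 * ((6 + 2 * c₀) * (2 * σ)) ^ 2 + 36 * σ * ((2 * (c₁ + 2 * c₀ ^ 2) + 24 * c₀ + 24) * (2 * σ))) + ((F.P K).d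 : ℝ) * (6 * ((6 + 2 * c₀) * (2 * σ)) * s₀ + 4 * s₀ * ((1 + 6 * σ) * ((6 + 2 * c₀) * (2 * σ)))))) := by
  obtain ⟨D, hD1, hD2, hD3, hD4, hD5⟩ := exists_smoothUntwistedChart_socket_T3 F h hk1 he W A₀ hA0 hs₀ hs₀' hs₁ u hXu hσ hσ0 hσc Fr hFr hFr1 ha₀ ha₁ hc₀ hc₁ hA
  -- sizes
  have hL2 : 2 ≤ (F.P K).L := by have := (F.P K).hL.2; omega
  have hℓ2 : 2 ≤ (F.P K).L ^ (K - n) := hL2.trans (Nat.le_self_pow (by omega) _)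
  have hℓ : (1 : ℝ) ≤ ((((F.P K).L ^ (K - n) : ℕ)) : ℝ) := by exact_mod_cast (le_trans (by norm_num) hℓ2)
  have hσnn : 0 ≤ σ := (GaugeGroup.dist1_nonneg _).trans (hσ (Classical.arbitrary _))
  have hs0nn : 0 ≤ s₀ := le_trans (by positivity) hs₀
  have hc0nn : 0 ≤ c₀ := le_trans (by positivity) hc₀
  have hK1nn : 0 ≤ ((6 + 2 * c₀) * (2 * σ)) := by positivity
  have hS₁ : (s₀ + (1 + 2 * s₀) * ((1 + 6 * σ) * ((6 + 2 * c₀) * (2 * σ)))) ≤ 1 / 4 := S₁_le_quarter hs0nn hs₀' hσnn hσ0 hK1nn hσc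
  -- pointwise `‖D b‖ ≤ 1∕4`
  have hDpt : ∀ b : PBond (F.P K) 0, ‖D b‖ ≤ 1 / 4 := by
    rintro ⟨z, μ⟩
    have h1 : ‖D ⟨z, μ⟩‖ ≤ ‖(fun (μ : Fin (F.P K).d) (z : Site (F.P K) 0) => D ⟨z, μ⟩)‖ := norm_bond_le_of_pi (fun (μ : Fin (F.P K).d) (z : Site (F.P K) 0) => D ⟨z, μ⟩) μ z
    have h2 : ‖(fun (μ : Fin (F.P K).d) (z : Site (F.P K) 0) => D ⟨z, μ⟩)‖ ≤ (s₀ + (1 + 2 * s₀) * ((1 + 6 * σ) * ((6 + 2 * c₀) * (2 * σ)))) := by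
      have h0 := norm_nonneg (fun (μ : Fin (F.P K).d) (z : Site (F.P K) 0) => D ⟨z, μ⟩)
      nlinarith [hD2]
    linarith
  -- the ratio is `e^{iD}`
  have hEn : ∀ (μ : Fin (F.P K).d) (y : Site (F.P K) 0), (((emb15 W (expHermField D) ⟨y, μ⟩ * (W ⟨y, μ⟩)⁻¹ : Matrix.specialUnitaryGroup (Fin 2) ℂ) : Matrix (Fin 2) (Fin 2) ℂ)) = exp (Complex.I • D ⟨y, μ⟩) := by
    intro μ y
    show (((expHerm (D ⟨y, μ⟩) * W ⟨y, μ⟩ * (W ⟨y, μ⟩)⁻¹ : Matrix.specialUnitaryGroup (Fin 2) ℂ)) : Matrix (Fin 2) (Fin 2) ℂ) = _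
    rw [mul_inv_cancel_right, coe_expHerm (hD1 ⟨y, μ⟩)]
  have hlog : ∀ (μ : Fin (F.P K).d) (y : Site (F.P K) 0), mlog (((emb15 W (expHermField D) ⟨y, μ⟩ * (W ⟨y, μ⟩)⁻¹ : Matrix.specialUnitaryGroup (Fin 2) ℂ) : Matrix (Fin 2) (Fin 2) ℂ)) = Complex.I • D ⟨y, μ⟩ := by
    intro μ y
    rw [hEn μ y]
    refine mlog_exp ?_
    rw [norm_smul, Complex.norm_I, one_mul]
    have := Real.log_two_gt_d9; linarith [hDpt ⟨y, μ⟩]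
  refine ⟨D, hD1, hD5, hD4, hEn, fun μ y => ?_, fun μ y => ?_, fun x => ?_⟩
  · rw [hEn μ y]
    have h1 : ‖Complex.I • D ⟨y, μ⟩‖ ≤ 1 / 4 := by rw [norm_smul, Complex.norm_I, one_mul]; exact hDpt ⟨y, μ⟩
    have := B7Eq214FlatQprime.norm_exp_sub_one_le_two_mul h1 (by norm_num)
    linarith
  · rw [hlog μ y, norm_smul, Complex.norm_I, one_mul, ← blockLetter_eq]
    exact (mul_le_mul_of_nonneg_left (norm_bond_le_of_pi (fun (μ : Fin (F.P K).d) (z : Site (F.P K) 0) => D ⟨z, μ⟩) μ y) (by positivity)).trans hD2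
  · have hfun : (fun (μ : Fin (F.P K).d) (y : Site (F.P K) 0) => mlog (((emb15 W (expHermField D) ⟨y, μ⟩ * (W ⟨y, μ⟩)⁻¹ : Matrix.specialUnitaryGroup (Fin 2) ℂ) : Matrix (Fin 2) (Fin 2) ℂ))) = fun μ y => Complex.I • D ⟨y, μ⟩ := by
      funext μ y; exact hlog μ y
    rw [hfun, divB_smul, norm_smul, Complex.norm_I, one_mul, ← blockLetter_eq]
    exact (mul_le_mul_of_nonneg_left (norm_le_pi_norm (fun x => divB (torusT (F.P K) 0) (fun κ z => unitsField (toUField W) ⟨z, κ⟩) (fun μ z => D ⟨z, μ⟩) x) x) (by positivity)).trans hD3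

end Summit.QuantumFields.YangMills.Theorems.Prop7SmoothUntwistEnRows

end
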